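import Mathlib
import Literature.MathematicalPhysics.QuantumManyBody.BoseEinsteinCondensation
import Summits.AtomisticToContinuum.BoseEinsteinCondensation.Theorems.SoloBlindBhattacharyya
import Summits.AtomisticToContinuum.BoseEinsteinCondensation.Theorems.SoloBlindJensenAffinity
import Summits.AtomisticToContinuum.BoseEinsteinCondensation.Theorems.SoloBlindMutualInformation
import Summits.AtomisticToContinuum.BoseEinsteinCondensation.Theorems.SoloBlindConditionalBEC

/-!
# Theorem 1′ in mutual-information form

Solo seat `solo-AtomisticToContinuum-blind`, conjunct `BoseEinsteinCondensation`.

`exists_affinity_ge_of_mutualInfo_le`: if the one-vs-rest mutual information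
`I(x₁ ; X̂) = KL(𝐏 ‖ 𝐏₁ ⊗ P̂)` of the Born law of a nonnegative `(n+1)`-particle amplitude `Φ` is
`≤ K`, then the mode `g = √ρ₁` (square root of the one-particle density) has Bhattacharyya affinity
`≥ e^{−K/2}`.

`hasGroundStateBEC_of_near_mutualInfo_le`: the assembly `hasGroundStateBEC_of_near_positive` with
this witness — if, eventually in `N` and at density `ρ`, every `δ_N`-near-minimiser is within `L²`
distance `ε` (modulo a phase) of some nonnegative normalised amplitude whose one-vs-rest mutual
information is `≤ K`, with `ε < e^{−K/2}`, then `HasGroundStateBEC v ρ` (with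
`c = (e^{−K/2} − ε)²`).  The two inputs are exactly the finite-volume identification and the open
`N`-uniform information bound `J_I` of the accompanying notes.
-/

open MeasureTheory Filter InformationTheory
open scoped ENNReal

namespace Summit.AtomisticToContinuum.BoseEinsteinCondensation.Theorems

open Literature.MathematicalPhysics.QuantumManyBody.BoseGas

/-- **Bounded mutual information gives an explicit mode of affinity `≥ e^{−K/2}`** (namely
`g = √ρ₁`). -/
theorem exists_affinity_ge_of_mutualInfo_le {n : ℕ} {Φ : Config (n + 1) → ℝ}
    (hΦm : Measurable Φ)
    (hΦ1 : ∫⁻ Y : Config n, ∫⁻ x, ENNReal.ofReal (Φ (Matrix.vecCons x Y)) ^ 2 = 1)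
    {K : ℝ} (hK0 : 0 ≤ K)
    (hI : klDiv
        (((volume : Measure Space).prod (volume : Measure (Config n))).withDensity
          fun z => ENNReal.ofReal (Φ (Matrix.vecCons z.1 z.2)) ^ 2)
        (((volume : Measure Space).withDensity
            fun x => ∫⁻ Y : Config n, ENNReal.ofReal (Φ (Matrix.vecCons x Y)) ^ 2).prod
          ((volume : Measure (Config n)).withDensity
            fun Y => ∫⁻ x, ENNReal.ofReal (Φ (Matrix.vecCons x Y)) ^ 2)) ≤ ENNReal.ofReal K) :
    ∃ g : Space → ℝ, 0 ≤ g ∧ Measurable g ∧ ∫⁻ x, ENNReal.ofReal (g x) ^ 2 = 1 ∧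
      ENNReal.ofReal (Real.exp (-K / 2)) ≤ ∫⁻ Y : Config n,
        (∫⁻ x, ENNReal.ofReal (g x) * ENNReal.ofReal (Φ (Matrix.vecCons x Y))) *
          (∫⁻ x, ENNReal.ofReal (Φ (Matrix.vecCons x Y)) ^ 2) ^ (1 / 2 : ℝ) := by
  have hpm : Measurable fun z : Space × Config n =>
      ENNReal.ofReal (Φ (Matrix.vecCons z.1 z.2)) ^ 2 :=
    ((hΦm.comp measurable_vecCons).ennreal_ofReal).pow_const 2
  have hρ : Measurable fun x : Space =>
      ∫⁻ Y : Config n, ENNReal.ofReal (Φ (Matrix.vecCons x Y)) ^ 2 :=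
    hpm.lintegral_prod_right'
  have hρ1 : ∫⁻ x : Space, ∫⁻ Y : Config n, ENNReal.ofReal (Φ (Matrix.vecCons x Y)) ^ 2 = 1 := by
    rw [lintegral_lintegral_swap hpm.aemeasurable]
    exact hΦ1
  have hρfin : ∀ᵐ x : Space, ∫⁻ Y : Config n, ENNReal.ofReal (Φ (Matrix.vecCons x Y)) ^ 2 < ⊤ :=
    ae_lt_top hρ (by rw [hρ1]; exact ENNReal.one_ne_top)
  set g : Space → ℝ := fun x =>
    Real.sqrt (∫⁻ Y : Config n, ENNReal.ofReal (Φ (Matrix.vecCons x Y)) ^ 2).toReal with hg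
  have hg0 : 0 ≤ g := fun x => Real.sqrt_nonneg _
  have hgm : Measurable g := hρ.ennreal_toReal.sqrt
  have hg2 : ∀ᵐ x : Space, ENNReal.ofReal (g x) ^ 2 =
      ∫⁻ Y : Config n, ENNReal.ofReal (Φ (Matrix.vecCons x Y)) ^ 2 := by
    filter_upwards [hρfin] with x hx
    rw [hg, ← ENNReal.ofReal_pow (Real.sqrt_nonneg _), Real.sq_sqrt ENNReal.toReal_nonneg,
      ENNReal.ofReal_toReal hx.ne]
  have hg1 : ∫⁻ x, ENNReal.ofReal (g x) ^ 2 = 1 := by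
    rw [lintegral_congr_ae hg2, hρ1]
  rw [← resampled_eq_prod_marginals hΦm hΦ1] at hI
  -- now `hI : KL(P ‖ g² ⊗ P̂) ≤ K` with this `g`; Jensen gives the affinity bound
  have hPhat : Measurable fun c : Config n => ∫⁻ y, ENNReal.ofReal (Φ (Matrix.vecCons y c)) ^ 2 :=
    hpm.lintegral_prod_left'
  have hqm : Measurable fun z : Space × Config n =>
      ENNReal.ofReal (g z.1) ^ 2 * ∫⁻ y, ENNReal.ofReal (Φ (Matrix.vecCons y z.2)) ^ 2 :=
    ((hgm.ennreal_ofReal.comp measurable_fst).pow_const 2).mul (hPhat.comp measurable_snd)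
  have hp1 := lintegral_born_eq_one hΦm hΦ1
  have hq1 := lintegral_resampled_eq_one hgm hΦm hg1 hΦ1
  have hexp := exp_neg_div_two_le_lintegral_sqrt_of_klDiv_symm_le
    ((volume : Measure Space).prod (volume : Measure (Config n))) hpm hqm hp1 hq1 hK0 hI
  have hΨm : Measurable (Function.uncurry fun (y : Space) (c : Config n) =>
      ENNReal.ofReal (Φ (Matrix.vecCons y c))) :=
    (hΦm.comp measurable_vecCons).ennreal_ofReal
  have hid := lintegral_sqrt_densities_eq (volume : Measure Space) (volume : Measure (Config n))
    hΨm hgm.ennreal_ofReal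
  refine ⟨g, hg0, hgm, hg1, ?_⟩
  rw [← hid]
  exact hexp.trans (le_of_eq (lintegral_congr fun z => rfl))

/-- **Theorem 1′, mutual-information form.** (Finite-volume identification input) ∧
(`N`-uniform one-vs-rest mutual information `≤ K` for the comparison amplitudes) ⇒
`HasGroundStateBEC v ρ`, provided the `L²` slack `ε` is `< e^{−K/2}`. -/
theorem hasGroundStateBEC_of_near_mutualInfo_le (v : ℝ → ℝ≥0∞) (ρ : ℝ) {K : ℝ} {ε : ℝ≥0∞}
    (hK0 : 0 ≤ K) (hε : ε < ENNReal.ofReal (Real.exp (-K / 2)))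
    (h : ∀ᶠ n : ℕ in atTop, ∃ δ : ℝ≥0∞, 0 < δ ∧
      ∀ Ψ : TrialState (n + 1) (sideLength ρ (n + 1)),
        energy v Ψ ≤ groundStateEnergy v (n + 1) (sideLength ρ (n + 1)) + δ →
        ∃ (Φ : Config (n + 1) → ℝ) (c : ℂ), 0 ≤ Φ ∧ Measurable Φ ∧ ‖c‖ = 1 ∧
          ∫⁻ Y : Config n, ∫⁻ x, ENNReal.ofReal (Φ (Matrix.vecCons x Y)) ^ 2 = 1 ∧
          klDiv
            (((volume : Measure Space).prod (volume : Measure (Config n))).withDensity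
              fun z => ENNReal.ofReal (Φ (Matrix.vecCons z.1 z.2)) ^ 2)
            (((volume : Measure Space).withDensity
                fun x => ∫⁻ Y : Config n, ENNReal.ofReal (Φ (Matrix.vecCons x Y)) ^ 2).prod
              ((volume : Measure (Config n)).withDensity
                fun Y => ∫⁻ x, ENNReal.ofReal (Φ (Matrix.vecCons x Y)) ^ 2)) ≤ ENNReal.ofReal K ∧
          ∫⁻ X, (‖Ψ.ψ X - c * Φ X‖₊ : ℝ≥0∞) ^ 2 ≤ ε ^ 2) :
    HasGroundStateBEC v ρ := by
  refine hasGroundStateBEC_of_near_positive v ρ hε ENNReal.ofReal_ne_top ?_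
  filter_upwards [h] with n hn
  obtain ⟨δ, hδ, hΨ⟩ := hn
  refine ⟨δ, hδ, fun Ψ hE => ?_⟩
  obtain ⟨Φ, c, hΦ0, hΦm, hc, hΦ1, hI, hnear⟩ := hΨ Ψ hE
  obtain ⟨g, hg0, hgm, hg1, hb⟩ := exists_affinity_ge_of_mutualInfo_le hΦm hΦ1 hK0 hI
  exact ⟨g, Φ, c, hg0, hΦ0, hgm, hΦm, hc, hg1, hΦ1, hb, hnear⟩

end Summit.AtomisticToContinuum.BoseEinsteinCondensation.Theorems
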